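import Mathlib.Analysis.InnerProductSpace.PiL2
import Literature.Geometry.DiscreteGeometry.TwoShellPatterns
import HarnessLib

/-!
# Two-shell good particles are star good (line `separation-padding-transfer`, stub `stub_twoShellGoodStarGood`)

Support file for the crux `ReggeStarCoercivity.StarCoercivity` (stmt-AtomisticToContinuum-13600), line
`separation-padding-transfer`: the transfer of the star-defect count to the two-shell-defect count of the
sibling inequality `PhononSlackCertificates.CoerciveTwoShellGap` (stmt-13956) rests on the pointwise
implication proved here,

  `IsTwoShellGood (1/20) (47/50) 1 x i → ∃ a ∈ [9/10, 11/10], ShellCloseTo (1/20) (shell x i a) K`,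
  `K = fccKissingPattern` or `K = hcpKissingPattern`,

where `shell x i a` is the recentred, `a⁻¹`-rescaled absolute `6/5`-shell of site `i` (verbatim sub-term of
the crux). PROOF (pattern arithmetic, same scale `a ∈ [47/50, 1]` and same isometry `A` as the two-shell match
`(A, P, f)`): a particle `j ≠ i` with `dist ≤ 6/5 ≤ 3a/2` is `f v` for some `v ∈ P`; if `‖v‖ = √2` then
`dist (x j) (x i) ≥ a (√2 − 1/20) > 6/5` (`√2 > 7/5`), so `‖v‖ = 1` and `v` lies in the first shell `K`
(the norm-one points of a two-shell pattern are exactly the kissing pattern, `mem_fccKissingPattern_iff`);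
conversely every `v ∈ K` has `dist (x (f v)) (x i) ≤ 21a/20 < 6/5`. Hence the shell is `K.image φ` with
`φ v = a⁻¹ • (x (f v) − x i)` injective on `K` (injectivity of `x` and of `f` on `P`), and `φ v ↦ A v` is a
bijection onto `K.image A` moving each point by `a⁻¹ · dist (x (f v)) (x i + a • A v) ≤ 1/20`.

Leans on `IsTwoShellGood`, `fccKissingPattern_subset`, `hcpKissingPattern_subset`,
`norm_of_mem_fccTwoShellPattern`, `norm_of_mem_hcpTwoShellPattern`, `norm_eq_one_of_mem_fcc/hcpKissingPattern`,
`norm_of_mem_scaledPattern` (`Literature/Geometry/DiscreteGeometry/{KissingPatterns,TwoShellPatterns}.lean`).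
No new definitions, no named facts.
-/

noncomputable section

open scoped Classical

namespace Summit.AtomisticToContinuum.Crystallization.Theorems.SeparationPaddingTransfer

open Literature.Geometry.DiscreteGeometry

/-! ## Matching two images of one finite set -/

/-- Two images of one finite set `K` under maps injective on `K` that move each point of `K` by `≤ η` are
`η`-matched (adapted from `etaMatched_image_image` of `ShellsToBarlowChart/Negative/Tolerance.lean`, with
`Set.InjOn` in place of global injectivity). -/
theorem etaMatched_image_of_injOn {η : ℝ} (K : Finset (EuclideanSpace ℝ (Fin 3)))
    {g g' : EuclideanSpace ℝ (Fin 3) → EuclideanSpace ℝ (Fin 3)} (hg : Set.InjOn g ↑K)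
    (hg' : Set.InjOn g' ↑K) (h : ∀ p ∈ K, dist (g p) (g' p) ≤ η) :
    EtaMatched η (K.image g) (K.image g') := by
  -- the two parametrisations by `K`
  let ι : ↥K → ↥(K.image g) := fun p => ⟨g p, Finset.mem_image_of_mem g p.2⟩
  let ι' : ↥K → ↥(K.image g') := fun p => ⟨g' p, Finset.mem_image_of_mem g' p.2⟩
  have hι : Function.Bijective ι := by
    refine ⟨fun p q hpq => Subtype.ext (hg p.2 q.2 (congrArg Subtype.val hpq)), fun y => ?_⟩
    obtain ⟨p, hp, hpy⟩ := Finset.mem_image.1 y.2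
    exact ⟨⟨p, hp⟩, Subtype.ext hpy⟩
  have hι' : Function.Bijective ι' := by
    refine ⟨fun p q hpq => Subtype.ext (hg' p.2 q.2 (congrArg Subtype.val hpq)), fun y => ?_⟩
    obtain ⟨p, hp, hpy⟩ := Finset.mem_image.1 y.2
    exact ⟨⟨p, hp⟩, Subtype.ext hpy⟩
  refine ⟨(Equiv.ofBijective ι hι).symm.trans (Equiv.ofBijective ι' hι'), fun t => ?_⟩
  obtain ⟨p, rfl⟩ := hι.2 t
  simp only [Equiv.trans_apply, Equiv.ofBijective_symm_apply_apply, Equiv.ofBijective_apply]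
  exact h p p.2

/-! ## The first shell inside the two-shell patterns -/

/-- The fcc second-shell integer vectors have squared norm `4`. -/
theorem sqNormInt_fccSecondShellInt : ∀ v ∈ fccSecondShellInt, sqNormInt v = 4 := by decide

/-- The hcp second-shell integer vectors have squared norm `36`. -/
theorem sqNormInt_hcpSecondShellInt : ∀ v ∈ hcpSecondShellInt, sqNormInt v = 36 := by decide

/-- Scaling a union of integer models gives the union of the scaled patterns. -/
theorem scaledPattern_union (S S' : Finset (Fin 3 → ℤ)) (n : ℕ) :
    scaledPattern (S ∪ S') n = scaledPattern S n ∪ scaledPattern S' n :=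
  Finset.image_union _ _

/-- The norm-one points of the fcc two-shell pattern are exactly the fcc kissing pattern (the second shell
has norm `√2 ≠ 1`). -/
theorem mem_fccKissingPattern_iff (v : EuclideanSpace ℝ (Fin 3)) :
    v ∈ fccKissingPattern ↔ v ∈ fccTwoShellPattern ∧ ‖v‖ = 1 := by
  constructor
  · exact fun h => ⟨fccKissingPattern_subset h, norm_eq_one_of_mem_fccKissingPattern h⟩
  · rintro ⟨hP, h1⟩
    rw [fccTwoShellPattern, scaledPattern_union, Finset.mem_union] at hP
    rcases hP with h | h
    · exact h
    · exfalso
      obtain ⟨w, hw, hn⟩ := norm_of_mem_scaledPattern two_ne_zero h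
      rw [sqNormInt_fccSecondShellInt w hw] at hn
      rw [hn, Real.sqrt_eq_one] at h1
      norm_num at h1

/-- The norm-one points of the hcp two-shell pattern are exactly the hcp kissing pattern (the second shell
has norm `√2 ≠ 1`). -/
theorem mem_hcpKissingPattern_iff (v : EuclideanSpace ℝ (Fin 3)) :
    v ∈ hcpKissingPattern ↔ v ∈ hcpTwoShellPattern ∧ ‖v‖ = 1 := by
  constructor
  · exact fun h => ⟨hcpKissingPattern_subset h, norm_eq_one_of_mem_hcpKissingPattern h⟩
  · rintro ⟨hP, h1⟩
    rw [hcpTwoShellPattern, scaledPattern_union, Finset.mem_union] at hP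
    rcases hP with h | h
    · exact h
    · exfalso
      obtain ⟨w, hw, hn⟩ := norm_of_mem_scaledPattern (by norm_num) h
      rw [sqNormInt_hcpSecondShellInt w hw] at hn
      rw [hn, Real.sqrt_eq_one] at h1
      norm_num at h1

/-! ## The transfer at a fixed match -/

/-- `7/5 < √2`. -/
theorem seven_fifths_lt_sqrt_two : (7 / 5 : ℝ) < Real.sqrt 2 :=
  (Real.lt_sqrt (by norm_num)).2 (by norm_num)

/-- **The core of the transfer.** If `(a, A, P, f)` is a two-way `a/20`-match of the `3a/2`-neighbourhood of
site `i` with a pattern `P` whose points have norm `1` or `√2`, `a ∈ [47/50, 1]`, and `K` is the set of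
norm-one points of `P`, then the recentred, `a⁻¹`-rescaled absolute `6/5`-shell of `i` is `1/20`-close to `K`
(with the same isometry `A`). -/
theorem shellCloseTo_of_twoShellMatch {N : ℕ} {x : Fin N → EuclideanSpace ℝ (Fin 3)} {i : Fin N}
    (hx : Function.Injective x) {a : ℝ} (ha1 : 47 / 50 ≤ a) (ha2 : a ≤ 1)
    (A : EuclideanSpace ℝ (Fin 3) →ₗᵢ[ℝ] EuclideanSpace ℝ (Fin 3)) (P K : Finset (EuclideanSpace ℝ (Fin 3)))
    (f : EuclideanSpace ℝ (Fin 3) → Fin N) (hK : ∀ v, v ∈ K ↔ v ∈ P ∧ ‖v‖ = 1)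
    (hPn : ∀ v ∈ P, ‖v‖ = 1 ∨ ‖v‖ = Real.sqrt 2)
    (hf : ∀ v ∈ P, f v ≠ i ∧ dist (x (f v)) (x i + a • A v) ≤ 1 / 20 * a) (hinj : Set.InjOn f ↑P)
    (hsurj : ∀ j : Fin N, j ≠ i → dist (x j) (x i) ≤ 3 / 2 * a → ∃ v ∈ P, f v = j) :
    ShellCloseTo (1 / 20)
      ((Finset.univ.filter fun j : Fin N => j ≠ i ∧ dist (x i) (x j) ≤ 6 / 5).image
        fun j => a⁻¹ • (x j - x i))
      K := by
  have hapos : 0 < a := by linarith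
  -- distance from `x i` of the ideal position of pattern point `v`
  have hideal : ∀ v : EuclideanSpace ℝ (Fin 3), dist (x i + a • A v) (x i) = a * ‖v‖ := fun v => by
    rw [dist_eq_norm, add_sub_cancel_left, norm_smul, Real.norm_of_nonneg hapos.le, A.norm_map]
  -- lower and upper bounds for the actual distance of the matched particle
  have hlow : ∀ v ∈ P, a * ‖v‖ ≤ 1 / 20 * a + dist (x (f v)) (x i) := fun v hv => by
    have h := dist_triangle (x i + a • A v) (x (f v)) (x i)
    rw [hideal v, dist_comm (x i + a • A v) (x (f v))] at h
    linarith [(hf v hv).2]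
  have hupp : ∀ v ∈ P, dist (x (f v)) (x i) ≤ 1 / 20 * a + a * ‖v‖ := fun v hv => by
    have h := dist_triangle (x (f v)) (x i + a • A v) (x i)
    rw [hideal v] at h
    linarith [(hf v hv).2]
  -- the rescaled relative position of the particle matched to `v`
  set φ : EuclideanSpace ℝ (Fin 3) → EuclideanSpace ℝ (Fin 3) := fun v => a⁻¹ • (x (f v) - x i)
    with hφ_def
  -- (1) the shell is the image of `K` under `φ`
  have hT : ((Finset.univ.filter fun j : Fin N => j ≠ i ∧ dist (x i) (x j) ≤ 6 / 5).image
      fun j => a⁻¹ • (x j - x i)) = K.image φ := by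
    ext z
    simp only [Finset.mem_image, Finset.mem_filter, Finset.mem_univ, true_and]
    constructor
    · rintro ⟨j, ⟨hji, hdj⟩, rfl⟩
      obtain ⟨v, hvP, hfv⟩ := hsurj j hji (by rw [dist_comm]; linarith)
      refine ⟨v, ?_, by simp only [hφ_def, hfv]⟩
      rw [hK]
      refine ⟨hvP, ?_⟩
      rcases hPn v hvP with h1 | h2
      · exact h1
      · exfalso
        have hl := hlow v hvP
        rw [h2, hfv, dist_comm] at hl
        nlinarith [seven_fifths_lt_sqrt_two, mul_nonneg (sub_nonneg.2 ha1)
          (sub_nonneg.2 seven_fifths_lt_sqrt_two.le)]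
    · rintro ⟨v, hvK, rfl⟩
      obtain ⟨hvP, hv1⟩ := (hK v).1 hvK
      refine ⟨f v, ⟨(hf v hvP).1, ?_⟩, rfl⟩
      have hu := hupp v hvP
      rw [hv1] at hu
      rw [dist_comm]
      linarith
  -- (2) `φ` is injective on `K`
  have hφ : Set.InjOn φ ↑K := by
    intro v hv w hw hvw
    have hvP := ((hK v).1 hv).1
    have hwP := ((hK w).1 hw).1
    have h1 : x (f v) - x i = x (f w) - x i :=
      smul_right_injective (EuclideanSpace ℝ (Fin 3)) (inv_ne_zero hapos.ne') hvw
    exact hinj hvP hwP (hx (sub_left_injective h1))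
  -- (3) each `φ v` is within `1/20` of `A v`
  have hdist : ∀ v ∈ K, dist (φ v) (A v) ≤ 1 / 20 := by
    intro v hvK
    have hvP := ((hK v).1 hvK).1
    have hvec : a⁻¹ • (x (f v) - x i) - A v = a⁻¹ • (x (f v) - (x i + a • A v)) := by
      rw [← sub_sub, smul_sub a⁻¹ (x (f v) - x i) (a • A v), inv_smul_smul₀ hapos.ne']
    calc dist (φ v) (A v) = ‖a⁻¹ • (x (f v) - (x i + a • A v))‖ := by
          rw [dist_eq_norm, hφ_def, hvec]
      _ = a⁻¹ * dist (x (f v)) (x i + a • A v) := by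
          rw [norm_smul, norm_inv, Real.norm_of_nonneg hapos.le, dist_eq_norm]
      _ ≤ a⁻¹ * (1 / 20 * a) := by gcongr; exact (hf v hvP).2
      _ = 1 / 20 := by field_simp
  -- conclusion
  refine ⟨A, ?_⟩
  rw [hT]
  exact etaMatched_image_of_injOn K hφ A.injective.injOn hdist

/-! ## The stub -/

/-- **Two-shell good ⇒ star good** (stub `stub_twoShellGoodStarGood` of line `separation-padding-transfer` for
the crux `ReggeStarCoercivity.StarCoercivity`, stmt-AtomisticToContinuum-13600): a particle `i` of an injective
configuration that is two-shell good (`IsTwoShellGood (1/20) (47/50) 1 x i`) is star good — for some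
`a ∈ [9/10, 11/10]` (namely the scale `a ∈ [47/50, 1]` of the two-shell match) its recentred, `a⁻¹`-rescaled
absolute `6/5`-shell is `1/20`-close, after a linear isometry, to `fccKissingPattern` or to
`hcpKissingPattern`. -/
theorem stub_twoShellGoodStarGood : ∀ (N : ℕ) (x : Fin N → EuclideanSpace ℝ (Fin 3)) (i : Fin N), Function.Injective x → Literature.Geometry.DiscreteGeometry.IsTwoShellGood (1 / 20) (47 / 50) 1 x i → ∃ a : ℝ, 9 / 10 ≤ a ∧ a ≤ 11 / 10 ∧ (Literature.Geometry.DiscreteGeometry.ShellCloseTo (1 / 20) ((Finset.univ.filter fun j : Fin N => j ≠ i ∧ dist (x i) (x j) ≤ 6 / 5).image fun j => a⁻¹ • (x j - x i)) Literature.Geometry.DiscreteGeometry.fccKissingPattern ∨ Literature.Geometry.DiscreteGeometry.ShellCloseTo (1 / 20) ((Finset.univ.filter fun j : Fin N => j ≠ i ∧ dist (x i) (x j) ≤ 6 / 5).image fun j => a⁻¹ • (x j - x i)) Literature.Geometry.DiscreteGeometry.hcpKissingPattern) := by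
  intro N x i hx h
  obtain ⟨a, ha1, ha2, A, P, f, hP, hf, hinj, hsurj⟩ := h
  refine ⟨a, by linarith, by linarith, ?_⟩
  rcases hP with rfl | rfl
  · exact Or.inl (shellCloseTo_of_twoShellMatch hx ha1 ha2 A _ _ f mem_fccKissingPattern_iff
      (fun v hv => norm_of_mem_fccTwoShellPattern hv) hf hinj hsurj)
  · exact Or.inr (shellCloseTo_of_twoShellMatch hx ha1 ha2 A _ _ f mem_hcpKissingPattern_iff
      (fun v hv => norm_of_mem_hcpTwoShellPattern hv) hf hinj hsurj)

end Summit.AtomisticToContinuum.Crystallization.Theorems.SeparationPaddingTransfer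

end
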